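import Literature.Analysis.Distribution.SchwartzFourierBilinForm
import Mathlib.Analysis.Distribution.SchwartzSpace.Fourier
import Mathlib.MeasureTheory.Measure.Lebesgue.EqHaar
import HarnessLib

/-!
# Fourier inversion for the transform attached to a symmetric non-degenerate pairing and an
# arbitrary Haar measure

`Literature/Analysis/Distribution` support file (everything proved; no definition, no named fact).
Companion of `SchwartzFourierBilinForm` (the transform `w ↦ ∫ 𝐞(-B(v, w)) f(v) dμ(v)` of a Schwartz
function is Schwartz). In the adelic applications the archimedean vector space `E = (K ⊗_ℚ ℝ)^ι`
carries the *trace pairing* `B(v, w) = Σ_i Tr(v_i w_i)` — symmetric and non-degenerate — and an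
arbitrary additive Haar measure `μ`; Tate's inversion theorem at the archimedean places
(Tate (1967), §2.2: "`f̂̂(x) = f(-x)`" for the self-dual measure, Thm. 2.2.2) then holds up to the
positive constant by which `μ` differs from the self-dual measure, squared. We PROVE:

* `fourier_comp_continuousLinearEquiv` — change of variables in Mathlib's Fourier transform on a
  finite-dimensional real inner product space `V`: for linear automorphisms `M, N` of `V` with
  `⟪M⁻¹ u, y⟫ = ⟪u, N y⟫` (i.e. `N = (M⁻¹)ᵀ`), `𝓕 (h ∘ M)(y) = |det M|⁻¹ • 𝓕 h (N y)`
  (Mathlib `MeasureTheory.Measure.map_linearMap_addHaar_eq_smul_addHaar`);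
* `SchwartzMap.exists_fourierChar_bilinForm_inversion` — **inversion**: for a symmetric
  non-degenerate bilinear form `B` on a finite-dimensional real normed space `E` and an additive Haar
  measure `μ` there is a constant `c > 0` (depending only on `E, B, μ`) with
  `∫ 𝐞(-B(w, x)) (∫ 𝐞(-B(v, w)) f(v) dμ(v)) dμ(w) = c • f(-x)` for every Schwartz `f` and every `x`.
  Proof: with `B(v, w) = ⟪T v, S w⟫` (`exists_continuousLinearEquiv_bilinForm_eq_inner`) and
  `T_* μ = c₁ · vol`, the transform is `c₁ · 𝓕(f ∘ T⁻¹) ∘ S`; applying it twice gives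
  `c₁² · 𝓕(𝓕(f ∘ T⁻¹) ∘ M) ∘ S` with `M = S T⁻¹`, whose inverse `N = T S⁻¹` is self-adjoint because
  `B` is symmetric; the change of variables and Mathlib's Fourier inversion for Schwartz functions
  (`Continuous.fourierInv_fourier_eq`, `Real.fourierInv_eq_fourier_neg`: `𝓕 𝓕 g = g(-·)`) finish,
  with `c = c₁² |det M|⁻¹`.

## References

* J. Tate, *Fourier analysis in number fields and Hecke's zeta-functions*, in Cassels–Fröhlich
  (eds.), *Algebraic Number Theory* (1967), Ch. XV, §2.2, Thm. 2.2.2 (local inversion formula at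
  `ℝ` and `ℂ` for `ψ(x) = e^{-2πi x}`, `e^{-2πi·2Re x}`) [CasselsFrohlichANT1967].
* L. Hörmander, *The Analysis of Linear Partial Differential Operators I*, Thm. 7.1.5 (Fourier
  inversion on `𝒮(ℝⁿ)`) [folklore].
-/

noncomputable section

open MeasureTheory MeasureTheory.Measure Real
open scoped FourierTransform SchwartzMap RealInnerProductSpace ENNReal NNReal

namespace Literature.Analysis.Distribution

variable {F : Type*} [NormedAddCommGroup F] [NormedSpace ℂ F]

section Euclidean

variable {V : Type*} [NormedAddCommGroup V] [InnerProductSpace ℝ V] [FiniteDimensional ℝ V]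
  [MeasurableSpace V] [BorelSpace V]

/-- **Change of variables under a linear automorphism in the Fourier transform.** If `M, N` are
linear automorphisms of the finite-dimensional real inner product space `V` with
`⟪M⁻¹ u, y⟫ = ⟪u, N y⟫` for all `u, y` (so `N` is the transpose of `M⁻¹`), then
`𝓕 (h ∘ M)(y) = |det M|⁻¹ • 𝓕 h (N y)` for every `h : V → F` (substitute `u = M⁻¹ u'`,
`du = |det M|⁻¹ du'`). [folklore] -/
theorem fourier_comp_continuousLinearEquiv (M N : V ≃L[ℝ] V)
    (hMN : ∀ u y, ⟪M.symm u, y⟫ = ⟪u, N y⟫) (h : V → F) (y : V) :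
    𝓕 (h ∘ M) y = |LinearMap.det (M.toLinearEquiv : V →ₗ[ℝ] V)|⁻¹ • 𝓕 h (N y) := by
  rw [fourier_eq, fourier_eq]
  have h1 : (fun u : V => 𝐞 (-⟪u, y⟫) • (h ∘ M) u) =
      fun u => (fun u' : V => 𝐞 (-⟪M.symm u', y⟫) • h u') (M u) := by
    funext u
    simp only [Function.comp_apply, ContinuousLinearEquiv.symm_apply_apply]
  rw [h1]
  have hmeas : (⇑M : V → V) = ⇑M.toHomeomorph.toMeasurableEquiv := by
    rw [Homeomorph.toMeasurableEquiv_coe]; rfl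
  have hdet : LinearMap.det (M.toLinearEquiv : V →ₗ[ℝ] V) ≠ 0 :=
    (LinearEquiv.isUnit_det' M.toLinearEquiv).ne_zero
  have hmap : Measure.map (⇑M.toHomeomorph.toMeasurableEquiv) (volume : Measure V) =
      ENNReal.ofReal |(LinearMap.det (M.toLinearEquiv : V →ₗ[ℝ] V))⁻¹| • (volume : Measure V) := by
    rw [← hmeas]
    exact map_linearMap_addHaar_eq_smul_addHaar volume hdet
  have hback := integral_map_equiv (μ := (volume : Measure V)) M.toHomeomorph.toMeasurableEquiv
    (fun u' : V => 𝐞 (-⟪M.symm u', y⟫) • h u')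
  rw [hmeas, ← hback, hmap, integral_smul_measure, ENNReal.toReal_ofReal (abs_nonneg _),
    abs_inv]
  congr 1
  refine integral_congr_ae (Filter.Eventually.of_forall fun u => ?_)
  simp only [hMN]

/-- `𝓕 𝓕 g = g(-·)` for a Schwartz function `g` on a finite-dimensional real inner product space
(Mathlib's Fourier inversion `𝓕⁻ 𝓕 g = g` and `𝓕⁻ = 𝓕 ∘ (-·)`). [folklore] -/
theorem fourier_fourier_schwartz_apply [CompleteSpace F] (g : 𝓢(V, F)) (y : V) :
    𝓕 (𝓕 (g : V → F)) y = g (-y) := by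
  have hint : Integrable (𝓕 (g : V → F)) := by
    rw [← SchwartzMap.fourier_coe]; exact (𝓕 g).integrable
  have h := g.continuous.fourierInv_fourier_eq g.integrable hint
  have h2 : 𝓕⁻ (𝓕 (g : V → F)) (-y) = g (-y) := by rw [h]
  rw [← h2, Real.fourierInv_eq_fourier_neg, neg_neg]

end Euclidean

variable {E : Type*} [NormedAddCommGroup E] [NormedSpace ℝ E] [FiniteDimensional ℝ E]
  [MeasurableSpace E] [BorelSpace E]

/-- **Fourier inversion for a symmetric non-degenerate pairing and an arbitrary Haar measure.**
For a finite-dimensional real normed space `E`, an additive Haar measure `μ` on `E` and a symmetric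
non-degenerate bilinear form `B` on `E` there is a constant `c > 0` such that for every Schwartz
function `f : E → F` and every `x ∈ E`,
`∫ 𝐞(-B(w, x)) (∫ 𝐞(-B(v, w)) f(v) dμ(v)) dμ(w) = c • f(-x)`.
(For the self-dual measure `c = 1`: Tate (1967), Thm. 2.2.2 at the archimedean places; in general
`c` is the square of the ratio of `μ` to the self-dual measure.) [folklore] -/
theorem SchwartzMap.exists_fourierChar_bilinForm_inversion [CompleteSpace F] (μ : Measure E)
    [μ.IsAddHaarMeasure] (B : LinearMap.BilinForm ℝ E) (hB : B.Nondegenerate)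
    (hBs : ∀ v w, B v w = B w v) :
    ∃ c : ℝ, 0 < c ∧ ∀ (f : 𝓢(E, F)) (x : E),
      ∫ w, 𝐞 (-(B w x)) • (∫ v, 𝐞 (-(B v w)) • f v ∂μ) ∂μ = c • f (-x) := by
  obtain ⟨T, S, hTS⟩ := exists_continuousLinearEquiv_bilinForm_eq_inner B hB
  set V := EuclideanSpace ℝ (Fin (Module.finrank ℝ E)) with hV
  -- `T_* μ` is a multiple of the volume
  set c₁ : ℝ≥0 := (μ.map T).addHaarScalarFactor (volume : Measure V) with hc₁
  have hμ : μ.map T = c₁ • (volume : Measure V) := isAddLeftInvariant_eq_smul _ _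
  have hc₁pos : 0 < c₁ := addHaarScalarFactor_pos_of_isAddHaarMeasure _ _
  -- `M = S T⁻¹`, `N = M⁻¹ = T S⁻¹`; `N` is self-adjoint since `B` is symmetric
  set M : V ≃L[ℝ] V := T.symm.trans S with hM
  set N : V ≃L[ℝ] V := S.symm.trans T with hN
  have hMsymm : ∀ u, M.symm u = N u := fun u => rfl
  have hNself : ∀ u y : V, ⟪N u, y⟫ = ⟪u, N y⟫ := by
    intro u y
    have h1 : ⟪N u, y⟫ = B (S.symm u) (S.symm y) := by
      rw [hTS, hN]
      simp only [ContinuousLinearEquiv.trans_apply, ContinuousLinearEquiv.apply_symm_apply]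
    have h2 : ⟪N y, u⟫ = B (S.symm y) (S.symm u) := by
      rw [hTS, hN]
      simp only [ContinuousLinearEquiv.trans_apply, ContinuousLinearEquiv.apply_symm_apply]
    rw [h1, hBs, ← h2, real_inner_comm]
  have hMN : ∀ u y : V, ⟪M.symm u, y⟫ = ⟪u, N y⟫ := fun u y => by rw [hMsymm, hNself]
  have hdet : LinearMap.det (M.toLinearEquiv : V →ₗ[ℝ] V) ≠ 0 :=
    (LinearEquiv.isUnit_det' M.toLinearEquiv).ne_zero
  -- the general one-step formula
  have step : ∀ (h : E → F) (w : E),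
      ∫ v, 𝐞 (-(B v w)) • h v ∂μ = (c₁ : ℝ) • 𝓕 (h ∘ T.symm) (S w) := by
    intro h w
    have hchange : ∫ v, 𝐞 (-(B v w)) • h v ∂μ =
        ∫ x : V, 𝐞 (-⟪x, S w⟫) • h (T.symm x) ∂(μ.map T) := by
      rw [show (⇑T : E → V) = ⇑T.toHomeomorph.toMeasurableEquiv by
        rw [Homeomorph.toMeasurableEquiv_coe]; rfl, integral_map_equiv]
      refine integral_congr_ae (Filter.Eventually.of_forall fun v => ?_)
      simp only [Homeomorph.toMeasurableEquiv_coe, ContinuousLinearEquiv.coe_toHomeomorph,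
        ContinuousLinearEquiv.symm_apply_apply, hTS]
    rw [hchange, hμ, integral_smul_nnreal_measure, NNReal.smul_def, fourier_eq]
    rfl
  refine ⟨(c₁ : ℝ) * (c₁ : ℝ) * |LinearMap.det (M.toLinearEquiv : V →ₗ[ℝ] V)|⁻¹,
    mul_pos (mul_pos (by exact_mod_cast hc₁pos) (by exact_mod_cast hc₁pos))
      (inv_pos.mpr (abs_pos.mpr hdet)), fun f x => ?_⟩
  -- the Euclidean model of `f`
  set f' : 𝓢(V, F) := SchwartzMap.compCLMOfContinuousLinearEquiv ℂ T.symm f with hf'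
  have hf'coe : ((f : E → F) ∘ T.symm) = (f' : V → F) := by
    rw [hf', SchwartzMap.compCLMOfContinuousLinearEquiv_apply]
  -- the inner transform, pulled back to `V`, is `c₁ • (𝓕 f') ∘ M`
  have hinner : ((fun w => ∫ v, 𝐞 (-(B v w)) • f v ∂μ) ∘ T.symm) =
      fun u => ((c₁ : ℝ) : ℂ) • ((𝓕 (f' : V → F)) ∘ M) u := by
    funext u
    rw [Function.comp_apply, step, hf'coe, Complex.coe_smul, Function.comp_apply, hM]
    rfl
  rw [step, hinner]
  -- linearity of `𝓕`
  have hlin : 𝓕 (fun u => ((c₁ : ℝ) : ℂ) • ((𝓕 (f' : V → F)) ∘ M) u) (S x) =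
      ((c₁ : ℝ) : ℂ) • 𝓕 ((𝓕 (f' : V → F)) ∘ M) (S x) := by
    rw [fourier_eq, fourier_eq, ← integral_smul]
    refine integral_congr_ae (Filter.Eventually.of_forall fun u => ?_)
    exact smul_comm _ _ _
  rw [hlin, fourier_comp_continuousLinearEquiv M N hMN, fourier_fourier_schwartz_apply]
  -- `N (S x) = T x` and `f' (-(T x)) = f (-x)`
  have hNS : N (S x) = T x := by
    rw [hN]
    simp only [ContinuousLinearEquiv.trans_apply, ContinuousLinearEquiv.symm_apply_apply]
  have hfx : f' (-(T x)) = f (-x) := by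
    rw [← hf'coe, Function.comp_apply, map_neg, ContinuousLinearEquiv.symm_apply_apply]
  rw [hNS, hfx, Complex.coe_smul, smul_smul, smul_smul]

end Literature.Analysis.Distribution

end
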